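import Literature.MathematicalPhysics.QuantumFieldTheory.Balaban1983to89.B9Eq321LandauMultiplierIffZdPer
import Literature.MathematicalPhysics.QuantumFieldTheory.Balaban1983to89.B9Eq324DeltaPrimeAZd
import Literature.MathematicalPhysics.QuantumFieldTheory.Balaban1983to89.B9Eq172FlatCurlPoincareZdPer

/-!
# `Balaban1983to89.B9Eq324DeltaPrimeAZdPer` — [Balaban1985BackgroundPropagators] (3.23)–(3.24) p. 394 and Thm 3.11 p. 416 (first clause) ON THE TORUS `T_P`
# READ ON `ℤᵈ`: the operator `Δ′_a(U₀) = Δ^η_{U₀} + Σ_j a_j Q′_j(U₀)ᵀ𝟙_{Λ_j}Q′_j(U₀)` on the `P`-PERIODIC site functions (the Hilbert space `L²(T_P, ·)` of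
# `B9Eq321LandauProjectionZdPer`), its quadratic form `⟨g, Δ′_a f⟩ = Σ_μ ⟨D_μ g, D_μ f⟩ + Σ_j a_j ⟨Q′_j g, Q′_j f⟩_{Λ_j}` over the period cell, symmetry and positivity,
# the INVERTIBILITY AT THE FLAT BACKGROUND (torus Liouville: `D¹f = 0 ⟹ f` constant; the averaging kills constants), and `G′(U₀) := (Δ′_a(U₀))⁻¹` as an object
# — the periodic twin of `B9Eq324DeltaPrimeAZd` (Dirichlet reading on a finite `Ω₀`)

statement-level skeleton of published theorems with citation tags; proofs where landed; nothing here is a claim about the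
Yang–Mills mass gap

`[Balaban1985BackgroundPropagators]` ("B9", CMP **99** (1985) 389–434) p. 394: *«let us define the operator Δ′_a = Δ^η_U + Σ_{j=0}^{k} a_j(L^jη)^{d−2} Q′_j*Q′_j,
a_j > 0, considered on functions restricted to Ω₀ … Its inverse is denoted by G′, or G′(U)»* (3.24), *«Δ^η_U = D^{η*}_U D^η_U»* (3.23), (3.19) p. 393; Thm 3.11
p. 416 *«the operators Δ′_a, G′, Q′G′²Q′* … are positive definite … This is obvious for the first three operators»*.  `[Balaban1985RegularSpaces]` ("B8", CMP
**99** (1985) 75–102) p. 77 *«we admit the case when some domains Ω_j are equal to T_η»*.  `[Balaban1984PropagatorsI]` p. 30 (1.72) (the torus Poincaré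
decomposition behind «D¹λ = 0 ⟹ λ constant»).  PDF held: `paper:balaban1985-cmp99-background-propagators` pp. 393–395, 416.

CITATION HEADER (lean-in-tree rule).  Cell `pub-ymgap` (YM Track A), DAG node N06 = [B9], width seat `pub-ymgap-dag-n06-w4` (g6), the (β′-PERIODIC) road of
director-ym №217 (1) ∕ plan g86 PENS-217.  WHY: on the periodic road every N06 object of the Dirichlet lineage is re-read on the finite-dimensional space of
`P`-periodic functions (periodicity in place of `(Ω 0).Finite`): the projection `R(U₀)` (`B9Eq321LandauProjectionZdPer`), the vector Green letter
(`B9Eq327GreenZdHermPer`), the Landau orthogonality (`B9Eq321LandauOrthogonalZdPer`).  THIS FILE is the SCALAR propagator side: (3.24)'s `Δ′_a` and `G′` on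
`T_P` — the first link of the (3.25) chain `R = I − G′Q′*(Q′G′²Q′*)⁻¹Q′G′` by which the w4 lineage proved the continuity of `R(U₀)` in `U₀` and Thm 3.11 near the
flat background at the `ℤᵈ` cube members (`B9Eq325ProjFormulaZd` ∕ `B9Eq325ProjContinuityZd` ∕ `B9Thm311PosDefNearFlatZd`).  Mechanism: the averaging penalty is
written with the EXPLICIT transpose stencil `Q′(U₀)ᵀ` of the B8 lineage (`B8Eq138LandauZd.QT`, multiplier `μ_j = a_j·Q′_j f`), so that the operator is a
site-function stencil defined for EVERY background (no proof arguments), read on `L²(T_P, ·)` through the periodisation `perRestrict` (identity on periodic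
data); the form identity is the companion files' cell calculus (`sum_box_pair_covLap_eq_sum`, `sum_box_pair_QT`); the flat kernel is dag-n06-w3's torus
Liouville `B9Eq172FlatCurlPoincareZdPer.periodic_eq_const_of_covDerivFwd_one_eq_zero` + «`Q′_j(1)c = c`» (`B7Eq214FlatQprime.QprimeIter_one_eq_sum_blockSites`).
Nothing is re-declared: `fibreForm` (the pairing `Re τ(a*b)`), `perSub ∕ formPer ∕ perRestrict`, `covLap ∕ QT ∕ QprimeIter ∕ bgT` are imported BY NAME.

WHAT IS DECLARED ∕ PROVED (kernel, 0 sorry; 3 `def`s with bodies + theorems; no `instance`, no `notation`).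
* §1 `penaltyMult` (`μ_j := a_j·Q′_j(U₀)f`), ★ `deltaPrimeAPerFun L U₀ η m a Λs f` (= `Δ^η_{U₀}f + Q′(U₀)ᵀ(𝟙_Λ·μ)`, (3.24) as a site stencil, every `U₀`),
  `deltaPrimeAPerFun_add ∕ _smul` (ℝ-linearity), `isPeriodic_deltaPrimeAPerFun` (periodic data ⟹ periodic image: `L ≥ 1`, `Lᵐ ∣ P`, `U₀` periodic, `Λ_j`
  `(P∕Lʲ)`-periodic), ★ `deltaPrimeAPer L U₀ η m a Λs P : perSub P →ₗ[ℝ] perSub P` (read on `L²(T_P, ·)` through `perRestrict`; `deltaPrimeAPer_coe_apply_of_mem_box`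
  — on the cell it IS the stencil, every `U₀`; `deltaPrimeAPer_coe` — on periodic data at a periodic background it IS the stencil everywhere).
* §2 ★★ `formPer_deltaPrimeAPer` (THE QUADRATIC FORM (3.23)–(3.24) ON THE CELL at a unitary periodic `U₀` with unitary averaged transporters:
  `⟨g, Δ′_a f⟩ = Σ_μ Σ_{x∈[0,P)ᵈ} Re τ((D_μg)(x)*(D_μf)(x)) + Σ_{j≤m} Σ_{y∈[0,P∕Lʲ)ᵈ} 𝟙_{Λ_j}(y)·a_j·Re τ((Q′_jg)(y)*(Q′_jf)(y))`), `formPer_deltaPrimeAPer_symm`,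
  `formPer_deltaPrimeAPer_self_nonneg` (`a ≥ 0`), ★ `covDerivFwd_eq_zero_of_form_eq_zero` ∕ `qprimeIter_eq_zero_of_form_eq_zero` (the kernel of the form:
  `⟨f, Δ′_a f⟩ = 0 ⟹ D^η_{U₀}f ≡ 0` and `Q′_j f = 0` on `Λ_j ∩ [0,P∕Lʲ)ᵈ` wherever `a_j > 0`).
* §3 (THM 3.11 FIRST CLAUSE ON THE TORUS, FLAT BACKGROUND) `qprimeIter_one_const` (`Q′_j(1)c = c`), ★★ `eq_zero_of_formPer_deltaPrimeAPer_one_eq_zero`,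
  ★★★ `formPer_deltaPrimeAPer_one_self_pos`, ★★★ `deltaPrimeAPer_one_injective` ∕ `deltaPrimeAPer_one_bijective`
  (`U₀ = 1`, `η ≠ 0`, `a ≥ 0`, and ONE level `j₀ ≤ m` with `a_{j₀} > 0` and `Λ_{j₀} ≠ ∅`: `Δ′_a(1)` is invertible on `L²(T_P, ·)` — torus Liouville + the averaging
  kills constants; NO Dirichlet boundary), `injective_of_form_pos` ∕ `bijective_of_form_pos` (positivity ⟹ invertibility, every `U₀`).
* §4 `RegularPrimePer` (the invertibility predicate, a `Prop`), ★ `GpPer` (`G′(U₀) := (Δ′_a(U₀))⁻¹` as a total object, `0` off the regime), `GpPer_deltaPrimeAPer`,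
  `deltaPrimeAPer_GpPer`, ★ `formPer_GpPer_self_pos` (`G′` positive definite where `Δ′_a` is positive), `formPer_GpPer_symm`, `regularPrimePer_one`.
* §5 A6 ∕ non-vacuity: `deltaPrimeAPer_one_bijective_complex` (`𝔸 = ℂ`, `τ = id`, `U₀ = 1`, the torus constraint set `Λ_m = univ`: every hypothesis discharged).

HONEST SCOPE.  (i) OBJECTS and finite-dimensional linear algebra; Thm 3.11's first clause is proved AT THE FLAT BACKGROUND ONLY (and wherever positivity is
given); NOT at a general unitary `U₀` (on the torus the kernel argument needs the intertwining of covariantly constant functions with the averaged transporters —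
not typed here), NOT uniformly; no estimate of Thm 3.1 ∕ (3.42).  (ii) The form identity displays UNITARY averaged transporters `Ū₀ʲ(Γ)` (`hT`) — [B7] Prop. 2's
output on the small-field class (`B9Thm311PosDefNearFlatZd.bgT_mem_unitaryUnits_of_reg17UnivP`), trivially true at `U₀ = 1`.  (iii) Print's level weights
`a_j(Lʲη)^{d−2}` are absorbed into `a j`.  (iv) Count-neutral; N05 ∕ N06 NOT discharged; K1⁹ `stmt-QuantumFields-27364` NOT closed; one finite `𝕋⁴` programme at
fixed `ε`, Bałaban as printed; R4 closes only the conditional finite-`𝕋⁴` rung `BalabanLadder.UV` — nothing continuum ∕ ℝ⁴ ∕ OS ∕ mass gap ∕ Clay.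
Unit `pub-ymgap-dag-n06-w4` (g6), 2026-08-28.
-/

noncomputable section

namespace Literature.MathematicalPhysics.QuantumFieldTheory.Balaban1983to89.B9Eq324DeltaPrimeAZdPer

open B7Prop1Explicit B7Eq78Linearization
open B7Prop2Explicit (unitaryUnits)
open B8Ineq132 (covDeriv covDerivFwd)
open B8Eq119TwistedAxial (bgT)
open B8Eq138LandauZd (covDivB covLap qprimeT1 QprimeT QT)
open Literature.MathematicalPhysics.QuantumLattice (blockSites card_blockSites)
open T4TermwiseTorus (IsPeriodic box mem_box tcls tlift tlift_mem_box tlift_tcls_of_mem_box)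
open B9Eq321LandauProjectionZdPer (perSub formPer formPer_apply perRestrict perRestrict_mem_perSub perRestrict_eq_self finiteDimensional_perSub
  isPeriodic_covLap)
open B9Eq321LandauMultiplierIffZd (QT_add QT_smul)
open B9Eq321LandauMultiplierIffZdPer (isPeriodic_QprimeIter isPeriodic_QT eq_pow_mul_div_of_dvd mem_iff_tlift_mem_of_isPeriodic)
open B9Eq321LandauOrthogonalZdPer (sum_box_pair_covLap_eq_sum sum_box_pair_QT)
open B9Eq324DeltaPrimeAZd (fibreForm fibreForm_apply fibreForm_comm fibreForm_invariant covLapLin covLapLin_apply)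

-- `Site` alone could resolve to the torus sites of `Setup.lean`; re-export the `ℤ^d` sites of `B7Prop1Explicit`.
export B7Prop1Explicit (Site)

variable {d : ℕ} {𝔸 : Type*} [CStarAlgebra 𝔸]

/-! ## §1  `Δ′_a(U₀)` as a site stencil and as an operator of `L²(T_P, ·)` -/

section Operator

variable (L : ℕ) (U₀ : Site d → Fin d → 𝔸ˣ) (η : ℝ) (m : ℕ) (a : ℕ → ℝ) (Λs : ℕ → Set (Site d))

/-- **THE LEVEL MULTIPLIER `μ_j := a_j·Q′_j(U₀)f`** of the averaging penalty of (3.24). [cite: Balaban1985BackgroundPropagators, (3.24) p.394, (3.19) p.393] -/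
def penaltyMult (f : Site d → 𝔸) : ℕ → Site d → 𝔸 := fun j y => a j • QprimeIter (zdBlocking d L) (bgT L U₀) j f y

/-- ★ **`Δ′_a(U₀)f := Δ^η_{U₀}f + Q′(U₀)ᵀ(𝟙_Λ · a · Q′(U₀)f)`** ((3.24) BEFORE the reading on `L²`, as a stencil on ALL site functions of `ℤᵈ`, at EVERY background):
the averaging penalty `Σ_j a_j Q′_jᵀ𝟙_{Λ_j}Q′_j f` written with the explicit transpose stencil `QT` of the B8 lineage. [cite: Balaban1985BackgroundPropagators, (3.24) p.394, (3.23) p.394, (3.19) p.393] -/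
def deltaPrimeAPerFun (f : Site d → 𝔸) : Site d → 𝔸 := fun x => covLap η U₀ f x + QT L m Λs U₀ (penaltyMult L U₀ a f) x

/-- the stencil unfolded. [cite: Balaban1985BackgroundPropagators, (3.24) p.394 (bookkeeping)] -/
theorem deltaPrimeAPerFun_apply (f : Site d → 𝔸) (x : Site d) :
    deltaPrimeAPerFun L U₀ η m a Λs f x = covLap η U₀ f x + QT L m Λs U₀ (penaltyMult L U₀ a f) x := rfl

/-- the multiplier is additive in `f`. [cite: Balaban1985BackgroundPropagators, (3.19) p.393 (bookkeeping)] -/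
theorem penaltyMult_add (f g : Site d → 𝔸) : penaltyMult L U₀ a (f + g) = penaltyMult L U₀ a f + penaltyMult L U₀ a g := by
  funext j y
  have h := congr_fun (QprimeIter_add (zdBlocking d L) (bgT L U₀) f g j) y
  simp only [penaltyMult, Pi.add_apply]
  rw [show (f + g) = fun x => f x + g x from rfl, h, smul_add]

/-- the multiplier is ℝ-homogeneous in `f`. [cite: Balaban1985BackgroundPropagators, (3.19) p.393 (bookkeeping)] -/
theorem penaltyMult_smul (c : ℝ) (f : Site d → 𝔸) : penaltyMult L U₀ a (c • f) = c • penaltyMult L U₀ a f := by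
  funext j y
  have h := congr_fun (QprimeIter_smul (zdBlocking d L) (bgT L U₀) (c : ℂ) f j) y
  simp only [Complex.coe_smul] at h
  simp only [penaltyMult, Pi.smul_apply]
  rw [show (c • f) = fun x => c • f x from rfl, h]
  exact smul_comm _ _ _

/-- the multiplier transpose is ℝ-homogeneous (the Dirichlet twin's `QT_smul` over `ℂ`, read at a real scalar).
[cite: Balaban1985BackgroundPropagators, (3.24) p.394 (bookkeeping)] -/
theorem QT_smul_real (c : ℝ) (μ : ℕ → Site d → 𝔸) (x : Site d) : QT L m Λs U₀ (c • μ) x = c • QT L m Λs U₀ μ x := by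
  have h := QT_smul L U₀ m Λs (c : ℂ) μ x
  have hμ : ((c : ℂ) • μ) = c • μ := by
    funext j y
    simp only [Pi.smul_apply, Complex.coe_smul]
  rw [hμ, Complex.coe_smul] at h
  exact h

/-- `Δ′_a(U₀)` is additive. [cite: Balaban1985BackgroundPropagators, (3.24) p.394 (bookkeeping)] -/
theorem deltaPrimeAPerFun_add (f g : Site d → 𝔸) :
    deltaPrimeAPerFun L U₀ η m a Λs (f + g) = deltaPrimeAPerFun L U₀ η m a Λs f + deltaPrimeAPerFun L U₀ η m a Λs g := by
  funext x
  have h1 : covLap η U₀ (f + g) x = covLap η U₀ f x + covLap η U₀ g x := by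
    have := congr_fun (map_add (covLapLin U₀ η) f g) x
    simpa only [covLapLin_apply, Pi.add_apply] using this
  simp only [deltaPrimeAPerFun, Pi.add_apply, h1, penaltyMult_add, QT_add]
  abel

/-- `Δ′_a(U₀)` is ℝ-homogeneous. [cite: Balaban1985BackgroundPropagators, (3.24) p.394 (bookkeeping)] -/
theorem deltaPrimeAPerFun_smul (c : ℝ) (f : Site d → 𝔸) :
    deltaPrimeAPerFun L U₀ η m a Λs (c • f) = c • deltaPrimeAPerFun L U₀ η m a Λs f := by
  funext x
  have h1 : covLap η U₀ (c • f) x = c • covLap η U₀ f x := by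
    have := congr_fun (map_smul (covLapLin U₀ η) c f) x
    simpa only [covLapLin_apply, Pi.smul_apply] using this
  simp only [deltaPrimeAPerFun, Pi.smul_apply, h1, penaltyMult_smul, QT_smul_real, smul_add]

variable {L U₀ m Λs} in
/-- **`Δ′_a(U₀)` PRESERVES PERIODICITY**: for `L ≥ 1`, `Lᵐ ∣ P`, a `P`-periodic `U₀`, `(P∕Lʲ)`-periodic constraint sets `Λ_j` and periodic `f`, `Δ′_a(U₀)f` is
`P`-periodic (`Δ^η_{U₀}` by `isPeriodic_covLap`, the penalty by the companion's `isPeriodic_QT` on the periodic multiplier `a_j·Q′_j f`).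
[cite: Balaban1985BackgroundPropagators, (3.24) p.394; Balaban1985RegularSpaces, p.77 («Ω_j = T_η»)] -/
theorem isPeriodic_deltaPrimeAPerFun {P : ℕ} (hL : 1 ≤ L) (hU : IsPeriodic P U₀) (hP : L ^ m ∣ P)
    (hΛ : ∀ j, j ≤ m → IsPeriodic (P / L ^ j) fun y => y ∈ Λs j) {f : Site d → 𝔸} (hf : IsPeriodic P f) :
    IsPeriodic P (deltaPrimeAPerFun L U₀ η m a Λs f) := by
  have hμ : ∀ j, j ≤ m → IsPeriodic (P / L ^ j) (penaltyMult L U₀ a f j) := by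
    intro j hj y n
    simp only [penaltyMult]
    rw [isPeriodic_QprimeIter hU hf (eq_pow_mul_div_of_dvd hP hj) y n]
  intro x n
  simp only [deltaPrimeAPerFun]
  rw [isPeriodic_covLap hU hf x n, isPeriodic_QT hL hU hP hΛ hμ x n]

variable (P : ℕ)

/-- ★ **`Δ′_a(U₀)` ON `L²(T_P, ·)`**: apply the stencil and read back on the torus through the periodisation-by-representatives `perRestrict` (the identity on
periodic data; the identity on the cell for ALL data) — an ℝ-linear operator of `perSub P` defined for EVERY background `U₀`, with no proof argument («The above
operator is considered on the subspace of L²», here the periodic subspace). [cite: Balaban1985BackgroundPropagators, (3.24) p.394; Balaban1985RegularSpaces, p.77 («Ω₀ = T_η»)] -/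
def deltaPrimeAPer : perSub (𝔸 := 𝔸) (d := d) P →ₗ[ℝ] perSub (𝔸 := 𝔸) (d := d) P where
  toFun f := ⟨perRestrict P (deltaPrimeAPerFun L U₀ η m a Λs (f : Site d → 𝔸)), perRestrict_mem_perSub P _⟩
  map_add' f g := by
    apply Subtype.ext
    funext x
    simp only [Submodule.coe_add, Pi.add_apply, perRestrict, deltaPrimeAPerFun_add]
  map_smul' c f := by
    apply Subtype.ext
    funext x
    simp only [Submodule.coe_smul, Pi.smul_apply, perRestrict, deltaPrimeAPerFun_smul, RingHom.id_apply]

/-- `Δ′_a(U₀)f`, unfolded. [cite: Balaban1985BackgroundPropagators, (3.24) p.394 (bookkeeping)] -/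
theorem deltaPrimeAPer_coe_apply (f : perSub (𝔸 := 𝔸) (d := d) P) (x : Site d) :
    (deltaPrimeAPer L U₀ η m a Λs P f : Site d → 𝔸) x = deltaPrimeAPerFun L U₀ η m a Λs (f : Site d → 𝔸) (tlift (tcls P x)) := rfl

/-- **ON THE CELL `Δ′_a(U₀)f` IS THE STENCIL**, for every `U₀` and every `f` (`perRestrict` is the identity on `[0,P)ᵈ`).
[cite: Balaban1985BackgroundPropagators, (3.24) p.394; Balaban1985RegularSpaces, p.77] -/
theorem deltaPrimeAPer_coe_apply_of_mem_box [NeZero P] (f : perSub (𝔸 := 𝔸) (d := d) P) {x : Site d} (hx : x ∈ box (d := d) P) :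
    (deltaPrimeAPer L U₀ η m a Λs P f : Site d → 𝔸) x = deltaPrimeAPerFun L U₀ η m a Λs (f : Site d → 𝔸) x := by
  rw [deltaPrimeAPer_coe_apply, tlift_tcls_of_mem_box hx]

variable {L U₀ m Λs P} in
/-- **ON PERIODIC DATA AT A PERIODIC BACKGROUND `Δ′_a(U₀)f` IS THE STENCIL EVERYWHERE** (`L ≥ 1`, `Lᵐ ∣ P`, `Λ_j` level-periodic).
[cite: Balaban1985BackgroundPropagators, (3.24) p.394; Balaban1985RegularSpaces, p.77] -/
theorem deltaPrimeAPer_coe [NeZero P] (hL : 1 ≤ L) (hU : IsPeriodic P U₀) (hP : L ^ m ∣ P)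
    (hΛ : ∀ j, j ≤ m → IsPeriodic (P / L ^ j) fun y => y ∈ Λs j) (f : perSub (𝔸 := 𝔸) (d := d) P) :
    (deltaPrimeAPer L U₀ η m a Λs P f : Site d → 𝔸) = deltaPrimeAPerFun L U₀ η m a Λs (f : Site d → 𝔸) :=
  perRestrict_eq_self P (isPeriodic_deltaPrimeAPerFun η a hL hU hP hΛ f.2)

end Operator

/-! ## §2  The quadratic form (3.23)–(3.24) on the cell; symmetry; positivity; the kernel of the form -/

section Form

variable (τ : 𝔸 →ₗ[ℂ] ℂ) {L : ℕ} [NeZero L] {U₀ : Site d → Fin d → 𝔸ˣ} {η : ℝ} {m : ℕ} {a : ℕ → ℝ} {Λs : ℕ → Set (Site d)} {P : ℕ} [NeZero P]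

/-- each diagonal term `Re τ(b* b)` is non-negative for a faithful positive trace. [folklore] -/
private theorem re_trace_star_mul_self_nonneg'' (hτp : ∀ a : 𝔸, a ≠ 0 → 0 < (τ (star a * a)).re) (b : 𝔸) : 0 ≤ (τ (star b * b)).re := by
  by_cases hb : b = 0
  · rw [hb, mul_zero, map_zero, Complex.zero_re]
  · exact (hτp b hb).le

/-- ★★ **THE QUADRATIC FORM (3.23)–(3.24) ON THE CELL**: at a UNITARY `P`-periodic background with unitary averaged transporters `Ū₀ʲ(Γ)`, for a tracial Hermitian
`τ`, `Lᵐ ∣ P`, and periodic `f, g`: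
`⟨g, Δ′_a(U₀)f⟩_{T_P} = Σ_μ Σ_{x∈[0,P)ᵈ} Re τ((D^η_{U₀,μ}g)(x)* (D^η_{U₀,μ}f)(x)) + Σ_{j ≤ m} Σ_{y∈[0,P∕Lʲ)ᵈ} 𝟙_{Λ_j}(y)·a_j·Re τ((Q′_jg)(y)* (Q′_jf)(y))` — the
Laplacian part by summation by parts on the torus, the penalty by the cell transpose identity. [cite: Balaban1985BackgroundPropagators, (3.23)–(3.24) p.394, (3.19) p.393; Balaban1985RegularSpaces, p.77 («Ω_j = T_η»)] -/
theorem formPer_deltaPrimeAPer (hτt : ∀ a b : 𝔸, τ (a * b) = τ (b * a))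
    (hUu : ∀ (x : Site d) (κ : Fin d), U₀ x κ ∈ unitaryUnits 𝔸) (hT : ∀ (j : ℕ) (z y : Site d), bgT L U₀ j z y ∈ unitaryUnits 𝔸)
    (hU : IsPeriodic P U₀) (hP : L ^ m ∣ P) (f g : perSub (𝔸 := 𝔸) (d := d) P) :
    formPer τ P g (deltaPrimeAPer L U₀ η m a Λs P f) =
      (∑ μ : Fin d, ∑ x ∈ box (d := d) P, (τ (star (covDerivFwd η U₀ μ (g : Site d → 𝔸) x) * covDerivFwd η U₀ μ (f : Site d → 𝔸) x)).re) +
        ∑ j ∈ Finset.range (m + 1), ∑ y ∈ box (d := d) (P / L ^ j),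
          (Λs j).indicator (fun y => a j * (τ (star (QprimeIter (zdBlocking d L) (bgT L U₀) j (g : Site d → 𝔸) y) *
            QprimeIter (zdBlocking d L) (bgT L U₀) j (f : Site d → 𝔸) y)).re) y := by
  rw [formPer_apply]
  have h0 : ∀ x ∈ box (d := d) P, (τ (star ((g : Site d → 𝔸) x) * (deltaPrimeAPer L U₀ η m a Λs P f : Site d → 𝔸) x)).re =
      fibreForm τ ((g : Site d → 𝔸) x) (covLap η U₀ (f : Site d → 𝔸) x) +
        fibreForm τ ((g : Site d → 𝔸) x) (QT L m Λs U₀ (penaltyMult L U₀ a (f : Site d → 𝔸)) x) := by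
    intro x hx
    rw [deltaPrimeAPer_coe_apply_of_mem_box L U₀ η m a Λs P f hx, deltaPrimeAPerFun_apply, fibreForm_apply, fibreForm_apply, mul_add, map_add,
      Complex.add_re]
  rw [Finset.sum_congr rfl h0, Finset.sum_add_distrib]
  have hB := fibreForm_invariant τ hτt
  congr 1
  · rw [sum_box_pair_covLap_eq_sum (fibreForm τ) (unitaryUnits 𝔸) P η U₀ hB hUu hU f.2 g.2]
    simp only [fibreForm_apply]
  · rw [sum_box_pair_QT (fibreForm τ) (unitaryUnits 𝔸) L U₀ hB hT hP (g : Site d → 𝔸) Λs (penaltyMult L U₀ a (f : Site d → 𝔸))]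
    refine Finset.sum_congr rfl fun j _ => Finset.sum_congr rfl fun y _ => ?_
    by_cases hy : y ∈ Λs j
    · simp only [Set.indicator_of_mem hy, penaltyMult, LinearMap.map_smul, fibreForm_apply, smul_eq_mul]
    · simp only [Set.indicator_of_notMem hy, map_zero]

/-- **SYMMETRY**: `⟨g, Δ′_a f⟩ = ⟨f, Δ′_a g⟩` on `L²(T_P, ·)` (same hypotheses). [cite: Balaban1985BackgroundPropagators, (3.24) p.394 (a symmetric operator)] -/
theorem formPer_deltaPrimeAPer_symm (hτt : ∀ a b : 𝔸, τ (a * b) = τ (b * a)) (hτs : ∀ a : 𝔸, τ (star a) = starRingEnd ℂ (τ a))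
    (hUu : ∀ (x : Site d) (κ : Fin d), U₀ x κ ∈ unitaryUnits 𝔸) (hT : ∀ (j : ℕ) (z y : Site d), bgT L U₀ j z y ∈ unitaryUnits 𝔸)
    (hU : IsPeriodic P U₀) (hP : L ^ m ∣ P) (f g : perSub (𝔸 := 𝔸) (d := d) P) :
    formPer τ P g (deltaPrimeAPer L U₀ η m a Λs P f) = formPer τ P f (deltaPrimeAPer L U₀ η m a Λs P g) := by
  rw [formPer_deltaPrimeAPer τ hτt hUu hT hU hP f g, formPer_deltaPrimeAPer τ hτt hUu hT hU hP g f]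
  congr 1
  · refine Finset.sum_congr rfl fun μ _ => Finset.sum_congr rfl fun x _ => ?_
    exact fibreForm_comm τ hτs _ _
  · refine Finset.sum_congr rfl fun j _ => Finset.sum_congr rfl fun y _ => ?_
    by_cases hy : y ∈ Λs j
    · rw [Set.indicator_of_mem hy, Set.indicator_of_mem hy]
      have h := fibreForm_comm τ hτs (QprimeIter (zdBlocking d L) (bgT L U₀) j (g : Site d → 𝔸) y)
        (QprimeIter (zdBlocking d L) (bgT L U₀) j (f : Site d → 𝔸) y)
      rw [fibreForm_apply, fibreForm_apply] at h
      rw [h]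
    · rw [Set.indicator_of_notMem hy, Set.indicator_of_notMem hy]

/-- **POSITIVITY**: `⟨f, Δ′_a f⟩ ≥ 0` for `a ≥ 0` and a faithful `τ` (a sum of `Re τ(b*b) ≥ 0`). [cite: Balaban1985BackgroundPropagators, Thm 3.11 p.416 («positive definite … obvious for the first three operators»)] -/
theorem formPer_deltaPrimeAPer_self_nonneg (hτt : ∀ a b : 𝔸, τ (a * b) = τ (b * a))
    (hτp : ∀ a : 𝔸, a ≠ 0 → 0 < (τ (star a * a)).re)
    (hUu : ∀ (x : Site d) (κ : Fin d), U₀ x κ ∈ unitaryUnits 𝔸) (hT : ∀ (j : ℕ) (z y : Site d), bgT L U₀ j z y ∈ unitaryUnits 𝔸)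
    (hU : IsPeriodic P U₀) (hP : L ^ m ∣ P) (ha : ∀ j, 0 ≤ a j) (f : perSub (𝔸 := 𝔸) (d := d) P) :
    0 ≤ formPer τ P f (deltaPrimeAPer L U₀ η m a Λs P f) := by
  rw [formPer_deltaPrimeAPer τ hτt hUu hT hU hP f f]
  refine add_nonneg (Finset.sum_nonneg fun μ _ => Finset.sum_nonneg fun x _ => re_trace_star_mul_self_nonneg'' τ hτp _)
    (Finset.sum_nonneg fun j _ => Finset.sum_nonneg fun y _ => ?_)
  by_cases hy : y ∈ Λs j
  · rw [Set.indicator_of_mem hy]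
    exact mul_nonneg (ha j) (re_trace_star_mul_self_nonneg'' τ hτp _)
  · rw [Set.indicator_of_notMem hy]

/-- ★ **THE KERNEL OF THE FORM, LAPLACIAN PART**: `⟨f, Δ′_a f⟩ = 0` (with `a ≥ 0`) forces `D^η_{U₀,μ}f = 0` at every site — on the cell by faithfulness of `τ`, off
the cell by periodicity. [cite: Balaban1985BackgroundPropagators, (3.23)–(3.24) p.394, Thm 3.11 p.416] -/
theorem covDerivFwd_eq_zero_of_form_eq_zero (hτt : ∀ a b : 𝔸, τ (a * b) = τ (b * a))
    (hτp : ∀ a : 𝔸, a ≠ 0 → 0 < (τ (star a * a)).re)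
    (hUu : ∀ (x : Site d) (κ : Fin d), U₀ x κ ∈ unitaryUnits 𝔸) (hT : ∀ (j : ℕ) (z y : Site d), bgT L U₀ j z y ∈ unitaryUnits 𝔸)
    (hU : IsPeriodic P U₀) (hP : L ^ m ∣ P) (ha : ∀ j, 0 ≤ a j) {f : perSub (𝔸 := 𝔸) (d := d) P}
    (h0 : formPer τ P f (deltaPrimeAPer L U₀ η m a Λs P f) = 0) (μ : Fin d) (x : Site d) :
    covDerivFwd η U₀ μ (f : Site d → 𝔸) x = 0 := by
  rw [formPer_deltaPrimeAPer τ hτt hUu hT hU hP f f] at h0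
  have hD : ∀ μ, 0 ≤ ∑ x ∈ box (d := d) P, (τ (star (covDerivFwd η U₀ μ (f : Site d → 𝔸) x) * covDerivFwd η U₀ μ (f : Site d → 𝔸) x)).re :=
    fun μ => Finset.sum_nonneg fun x _ => re_trace_star_mul_self_nonneg'' τ hτp _
  have hQ : 0 ≤ ∑ j ∈ Finset.range (m + 1), ∑ y ∈ box (d := d) (P / L ^ j),
      (Λs j).indicator (fun y => a j * (τ (star (QprimeIter (zdBlocking d L) (bgT L U₀) j (f : Site d → 𝔸) y) *
        QprimeIter (zdBlocking d L) (bgT L U₀) j (f : Site d → 𝔸) y)).re) y := by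
    refine Finset.sum_nonneg fun j _ => Finset.sum_nonneg fun y _ => ?_
    by_cases hy : y ∈ Λs j
    · rw [Set.indicator_of_mem hy]; exact mul_nonneg (ha j) (re_trace_star_mul_self_nonneg'' τ hτp _)
    · rw [Set.indicator_of_notMem hy]
  have hDsum : ∑ μ : Fin d, ∑ x ∈ box (d := d) P,
      (τ (star (covDerivFwd η U₀ μ (f : Site d → 𝔸) x) * covDerivFwd η U₀ μ (f : Site d → 𝔸) x)).re = 0 := by
    have := Finset.sum_nonneg fun μ (_ : μ ∈ (Finset.univ : Finset (Fin d))) => hD μ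
    linarith
  have hμ := (Finset.sum_eq_zero_iff_of_nonneg fun μ _ => hD μ).1 hDsum μ (Finset.mem_univ _)
  -- on the cell
  have hcell : ∀ y ∈ box (d := d) P, covDerivFwd η U₀ μ (f : Site d → 𝔸) y = 0 := by
    intro y hy
    by_contra hne
    have := (Finset.sum_eq_zero_iff_of_nonneg fun z _ => re_trace_star_mul_self_nonneg'' τ hτp _).1 hμ y hy
    exact (hτp _ hne).ne' this
  -- off the cell by periodicity
  have hper : IsPeriodic P (covDerivFwd η U₀ μ (f : Site d → 𝔸)) :=
    B9Eq321LandauProjectionZdPer.isPeriodic_covDerivFwd hU f.2 μ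
  rw [← IsPeriodic.apply_tlift hper x]
  exact hcell _ (tlift_mem_box _)

/-- ★ **THE KERNEL OF THE FORM, AVERAGING PART**: `⟨f, Δ′_a f⟩ = 0` (with `a ≥ 0`) forces `(Q′_j(U₀)f)(y) = 0` at every constraint point `y ∈ Λ_j` of the
level-`j` cell where the weight is positive (`a_j > 0`). [cite: Balaban1985BackgroundPropagators, (3.24) p.394, Thm 3.11 p.416] -/
theorem qprimeIter_eq_zero_of_form_eq_zero (hτt : ∀ a b : 𝔸, τ (a * b) = τ (b * a))
    (hτp : ∀ a : 𝔸, a ≠ 0 → 0 < (τ (star a * a)).re)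
    (hUu : ∀ (x : Site d) (κ : Fin d), U₀ x κ ∈ unitaryUnits 𝔸) (hT : ∀ (j : ℕ) (z y : Site d), bgT L U₀ j z y ∈ unitaryUnits 𝔸)
    (hU : IsPeriodic P U₀) (hP : L ^ m ∣ P) (ha : ∀ j, 0 ≤ a j) {f : perSub (𝔸 := 𝔸) (d := d) P}
    (h0 : formPer τ P f (deltaPrimeAPer L U₀ η m a Λs P f) = 0) {j : ℕ} (hj : j ≤ m) (haj : 0 < a j) {y : Site d}
    (hy : y ∈ Λs j) (hyb : y ∈ box (d := d) (P / L ^ j)) :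
    QprimeIter (zdBlocking d L) (bgT L U₀) j (f : Site d → 𝔸) y = 0 := by
  rw [formPer_deltaPrimeAPer τ hτt hUu hT hU hP f f] at h0
  have hD : 0 ≤ ∑ μ : Fin d, ∑ x ∈ box (d := d) P,
      (τ (star (covDerivFwd η U₀ μ (f : Site d → 𝔸) x) * covDerivFwd η U₀ μ (f : Site d → 𝔸) x)).re :=
    Finset.sum_nonneg fun μ _ => Finset.sum_nonneg fun x _ => re_trace_star_mul_self_nonneg'' τ hτp _
  have hterm : ∀ j' y', 0 ≤ (Λs j').indicator (fun y => a j' * (τ (star (QprimeIter (zdBlocking d L) (bgT L U₀) j' (f : Site d → 𝔸) y) *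
      QprimeIter (zdBlocking d L) (bgT L U₀) j' (f : Site d → 𝔸) y)).re) y' := by
    intro j' y'
    by_cases hy' : y' ∈ Λs j'
    · rw [Set.indicator_of_mem hy']; exact mul_nonneg (ha j') (re_trace_star_mul_self_nonneg'' τ hτp _)
    · rw [Set.indicator_of_notMem hy']
  have hQ : 0 ≤ ∑ j ∈ Finset.range (m + 1), ∑ y ∈ box (d := d) (P / L ^ j),
      (Λs j).indicator (fun y => a j * (τ (star (QprimeIter (zdBlocking d L) (bgT L U₀) j (f : Site d → 𝔸) y) *
        QprimeIter (zdBlocking d L) (bgT L U₀) j (f : Site d → 𝔸) y)).re) y :=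
    Finset.sum_nonneg fun j _ => Finset.sum_nonneg fun y _ => hterm j y
  have hQsum : ∑ j ∈ Finset.range (m + 1), ∑ y ∈ box (d := d) (P / L ^ j),
      (Λs j).indicator (fun y => a j * (τ (star (QprimeIter (zdBlocking d L) (bgT L U₀) j (f : Site d → 𝔸) y) *
        QprimeIter (zdBlocking d L) (bgT L U₀) j (f : Site d → 𝔸) y)).re) y = 0 := by linarith
  have hj' : j ∈ Finset.range (m + 1) := Finset.mem_range.2 (Nat.lt_succ_of_le hj)
  have hlev := (Finset.sum_eq_zero_iff_of_nonneg fun j _ => Finset.sum_nonneg fun y _ => hterm j y).1 hQsum j hj'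
  have hpt := (Finset.sum_eq_zero_iff_of_nonneg fun y _ => hterm j y).1 hlev y hyb
  rw [Set.indicator_of_mem hy] at hpt
  by_contra hne
  have hpos := mul_pos haj (hτp _ hne)
  exact hpos.ne' hpt

end Form

/-! ## §3  Theorem 3.11, first clause, on the torus at the flat background: `Δ′_a(1)` is invertible on `L²(T_P, ·)` -/

section Flat

variable (τ : 𝔸 →ₗ[ℂ] ℂ) {L : ℕ} [NeZero L] {η : ℝ} {m : ℕ} {a : ℕ → ℝ} {Λs : ℕ → Set (Site d)} {P : ℕ} [NeZero P]

omit [NeZero P] in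
/-- **THE AVERAGING OF A CONSTANT IS THE CONSTANT at the flat background**: `Q′_j(1)c = c` (the `Lʲ`-block mean of `B7Eq214FlatQprime.QprimeIter_one_eq_sum_blockSites`,
`L^{jd}` sites of weight `L^{−jd}`). [cite: Balaban1985Averaging, (78) p.30 (normalised weights), (212) p.50; Balaban1985BackgroundPropagators, (3.19) p.393] -/
theorem qprimeIter_one_const (hL : 1 ≤ L) (c : 𝔸) (j : ℕ) (y : Site d) :
    QprimeIter (zdBlocking d L) (bgT L (1 : Site d → Fin d → 𝔸ˣ)) j (fun _ => c) y = c := by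
  rw [B8Eq119TwistedAxial.bgT_one, B7Eq214FlatQprime.QprimeIter_one_eq_sum_blockSites hL (fun _ => c) j y, Finset.sum_const, card_blockSites,
    ← Nat.cast_smul_eq_nsmul ℝ, smul_smul]
  have hL' : ((L : ℝ) ^ (j * d)) ≠ 0 := pow_ne_zero _ (by exact_mod_cast (Nat.pos_of_ne_zero (NeZero.ne L)).ne')
  have h1 : (((L ^ j) ^ d : ℕ) : ℝ) * ((L : ℝ) ^ (j * d))⁻¹ = 1 := by
    push_cast
    rw [← pow_mul, mul_inv_cancel₀ hL']
  rw [h1, one_smul]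

/-- ★★ **THE KERNEL OF THE FORM AT THE FLAT BACKGROUND IS TRIVIAL**: `U₀ = 1`, `η ≠ 0`, `a ≥ 0`, `Lᵐ ∣ P`, a tracial faithful `τ`, and ONE level `j₀ ≤ m` with
`a_{j₀} > 0` whose constraint set `Λ_{j₀}` is `(P∕L^{j₀})`-periodic and NON-EMPTY: `⟨f, Δ′_a(1)f⟩ = 0 ⟹ f = 0` — a kernel element has `D¹f ≡ 0` (§2), hence is CONSTANT on
the torus (dag-n06-w3's torus Liouville), and `Q′_{j₀}(1)` of a constant is the constant, which the penalty kills at a point of `Λ_{j₀}`; NO Dirichlet boundary is used.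
[cite: Balaban1985BackgroundPropagators, Thm 3.11 p.416 («Δ′_a, G′ … are positive definite. This is obvious»), (3.24) p.394; Balaban1984PropagatorsI, (1.72) p.30] -/
theorem eq_zero_of_formPer_deltaPrimeAPer_one_eq_zero (hη : η ≠ 0) (hL : 1 ≤ L) (hτt : ∀ a b : 𝔸, τ (a * b) = τ (b * a))
    (hτp : ∀ a : 𝔸, a ≠ 0 → 0 < (τ (star a * a)).re)
    (hP : L ^ m ∣ P) (ha : ∀ j, 0 ≤ a j) {j₀ : ℕ} (hj₀ : j₀ ≤ m) (haj₀ : 0 < a j₀)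
    (hΛ₀ : IsPeriodic (P / L ^ j₀) fun y => y ∈ Λs j₀) (hne : (Λs j₀).Nonempty) {f : perSub (𝔸 := 𝔸) (d := d) P}
    (h0 : formPer τ P f (deltaPrimeAPer L (1 : Site d → Fin d → 𝔸ˣ) η m a Λs P f) = 0) : f = 0 := by
  have hU1 : ∀ (x : Site d) (κ : Fin d), (1 : Site d → Fin d → 𝔸ˣ) x κ ∈ unitaryUnits 𝔸 := fun _ _ => (unitaryUnits 𝔸).one_mem
  have hT1 : ∀ (j : ℕ) (z y : Site d), bgT L (1 : Site d → Fin d → 𝔸ˣ) j z y ∈ unitaryUnits 𝔸 := fun j z y => by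
    rw [B8Eq119TwistedAxial.bgT_one]; exact (unitaryUnits 𝔸).one_mem
  have hUper : IsPeriodic P (1 : Site d → Fin d → 𝔸ˣ) := fun _ _ => rfl
  -- `D¹f ≡ 0` ⟹ `f` constant
  have hD := covDerivFwd_eq_zero_of_form_eq_zero τ hτt hτp hU1 hT1 hUper hP ha h0
  have hconst : ∀ x, (f : Site d → 𝔸) x = (f : Site d → 𝔸) 0 :=
    fun x => B9Eq172FlatCurlPoincareZdPer.periodic_eq_const_of_covDerivFwd_one_eq_zero P hη f.2 hD x
  -- the penalty at the representative of a point of `Λ_{j₀}` kills the constant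
  obtain ⟨y₁, hy₁⟩ := hne
  set Q : ℕ := P / L ^ j₀ with hQ
  have hPQ : P = L ^ j₀ * Q := eq_pow_mul_div_of_dvd hP hj₀
  haveI : NeZero Q := ⟨fun hq => NeZero.ne P (by rw [hPQ, hq, mul_zero])⟩
  have hy₀ : tlift (tcls Q y₁) ∈ Λs j₀ := (mem_iff_tlift_mem_of_isPeriodic hΛ₀ y₁).1 hy₁
  have hQ0 := qprimeIter_eq_zero_of_form_eq_zero τ hτt hτp hU1 hT1 hUper hP ha h0 hj₀ haj₀ hy₀ (by rw [← hQ]; exact tlift_mem_box _)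
  have hfc : (f : Site d → 𝔸) = fun _ => (f : Site d → 𝔸) 0 := funext hconst
  rw [hfc, qprimeIter_one_const hL] at hQ0
  apply Subtype.ext
  funext x
  rw [hconst x, hQ0, Submodule.coe_zero, Pi.zero_apply]

/-- ★★★ **THM 3.11, FIRST CLAUSE, ON THE TORUS AT THE FLAT BACKGROUND — POSITIVITY**: under the same hypotheses `⟨f, Δ′_a(1)f⟩ > 0` for `f ≠ 0` on `L²(T_P, ·)`.
[cite: Balaban1985BackgroundPropagators, Thm 3.11 p.416, (3.24) p.394] -/
theorem formPer_deltaPrimeAPer_one_self_pos (hη : η ≠ 0) (hL : 1 ≤ L) (hτt : ∀ a b : 𝔸, τ (a * b) = τ (b * a))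
    (hτp : ∀ a : 𝔸, a ≠ 0 → 0 < (τ (star a * a)).re)
    (hP : L ^ m ∣ P) (ha : ∀ j, 0 ≤ a j) {j₀ : ℕ} (hj₀ : j₀ ≤ m) (haj₀ : 0 < a j₀)
    (hΛ₀ : IsPeriodic (P / L ^ j₀) fun y => y ∈ Λs j₀) (hne : (Λs j₀).Nonempty) {f : perSub (𝔸 := 𝔸) (d := d) P} (hf : f ≠ 0) :
    0 < formPer τ P f (deltaPrimeAPer L (1 : Site d → Fin d → 𝔸ˣ) η m a Λs P f) := by
  have hU1 : ∀ (x : Site d) (κ : Fin d), (1 : Site d → Fin d → 𝔸ˣ) x κ ∈ unitaryUnits 𝔸 := fun _ _ => (unitaryUnits 𝔸).one_mem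
  have hT1 : ∀ (j : ℕ) (z y : Site d), bgT L (1 : Site d → Fin d → 𝔸ˣ) j z y ∈ unitaryUnits 𝔸 := fun j z y => by
    rw [B8Eq119TwistedAxial.bgT_one]; exact (unitaryUnits 𝔸).one_mem
  have hnn := formPer_deltaPrimeAPer_self_nonneg τ hτt hτp hU1 hT1 (fun _ _ => rfl) hP ha f (η := η) (Λs := Λs)
  rcases hnn.lt_or_eq with hlt | heq
  · exact hlt
  · exact absurd (eq_zero_of_formPer_deltaPrimeAPer_one_eq_zero τ hη hL hτt hτp hP ha hj₀ haj₀ hΛ₀ hne heq.symm) hf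

/-- ★★★ **THM 3.11, FIRST CLAUSE, ON THE TORUS AT THE FLAT BACKGROUND — INJECTIVITY** (same hypotheses). [cite: Balaban1985BackgroundPropagators, Thm 3.11 p.416, (3.24) p.394; Balaban1984PropagatorsI, (1.72) p.30] -/
theorem deltaPrimeAPer_one_injective (hη : η ≠ 0) (hL : 1 ≤ L) (hτt : ∀ a b : 𝔸, τ (a * b) = τ (b * a))
    (hτp : ∀ a : 𝔸, a ≠ 0 → 0 < (τ (star a * a)).re)
    (hP : L ^ m ∣ P) (ha : ∀ j, 0 ≤ a j) {j₀ : ℕ} (hj₀ : j₀ ≤ m) (haj₀ : 0 < a j₀)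
    (hΛ₀ : IsPeriodic (P / L ^ j₀) fun y => y ∈ Λs j₀) (hne : (Λs j₀).Nonempty) :
    Function.Injective (deltaPrimeAPer L (1 : Site d → Fin d → 𝔸ˣ) η m a Λs P) := by
  rw [← LinearMap.ker_eq_bot, Submodule.eq_bot_iff]
  intro f hf
  rw [LinearMap.mem_ker] at hf
  refine eq_zero_of_formPer_deltaPrimeAPer_one_eq_zero τ hη hL hτt hτp hP ha hj₀ haj₀ hΛ₀ hne ?_
  rw [hf, map_zero]

/-- ★★★ **… AND BIJECTIVITY** (finite-dimensional `L²(T_P, ·)`): `Δ′_a(1)` is INVERTIBLE on the torus under the hypotheses of `deltaPrimeAPer_one_injective` and a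
finite-dimensional fibre. [cite: Balaban1985BackgroundPropagators, Thm 3.11 p.416, (3.24) p.394 («Its inverse is denoted by G′»)] -/
theorem deltaPrimeAPer_one_bijective [FiniteDimensional ℝ 𝔸] (hη : η ≠ 0) (hL : 1 ≤ L) (hτt : ∀ a b : 𝔸, τ (a * b) = τ (b * a))
    (hτp : ∀ a : 𝔸, a ≠ 0 → 0 < (τ (star a * a)).re)
    (hP : L ^ m ∣ P) (ha : ∀ j, 0 ≤ a j) {j₀ : ℕ} (hj₀ : j₀ ≤ m) (haj₀ : 0 < a j₀)
    (hΛ₀ : IsPeriodic (P / L ^ j₀) fun y => y ∈ Λs j₀) (hne : (Λs j₀).Nonempty) :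
    Function.Bijective (deltaPrimeAPer L (1 : Site d → Fin d → 𝔸ˣ) η m a Λs P) := by
  haveI := finiteDimensional_perSub (𝔸 := 𝔸) (d := d) P
  have hinj := deltaPrimeAPer_one_injective τ hη hL hτt hτp hP ha hj₀ haj₀ hΛ₀ hne (η := η) (a := a) (Λs := Λs)
  exact ⟨hinj, LinearMap.injective_iff_surjective.1 hinj⟩

omit [NeZero L] in
/-- **POSITIVITY ⟹ INVERTIBILITY AT ANY BACKGROUND**: if the form `⟨f, Δ′_a(U₀)f⟩_{T_P}` is positive on `L²(T_P, ·) ∖ 0`, then `Δ′_a(U₀)` is injective, hence (finite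
dimension) bijective — the shape in which a coercivity estimate at a curved `U₀` (Thm 3.1's road) delivers `G′(U₀)` on the torus. [cite: Balaban1985BackgroundPropagators, Thm 3.11 p.416, (3.24) p.394] -/
theorem bijective_of_form_pos [FiniteDimensional ℝ 𝔸] {U₀ : Site d → Fin d → 𝔸ˣ}
    (hpos : ∀ f : perSub (𝔸 := 𝔸) (d := d) P, f ≠ 0 → 0 < formPer τ P f (deltaPrimeAPer L U₀ η m a Λs P f)) :
    Function.Bijective (deltaPrimeAPer L U₀ η m a Λs P) := by
  haveI := finiteDimensional_perSub (𝔸 := 𝔸) (d := d) P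
  have hinj : Function.Injective (deltaPrimeAPer L U₀ η m a Λs P) := by
    rw [← LinearMap.ker_eq_bot, Submodule.eq_bot_iff]
    intro f hf
    rw [LinearMap.mem_ker] at hf
    by_contra hne
    have h := hpos f hne
    rw [hf, map_zero] at h
    exact lt_irrefl _ h
  exact ⟨hinj, LinearMap.injective_iff_surjective.1 hinj⟩

end Flat

/-! ## §4  `G′(U₀) := (Δ′_a(U₀))⁻¹` on `L²(T_P, ·)` as an object -/

section GreenPrime

variable (τ : 𝔸 →ₗ[ℂ] ℂ) (L : ℕ) (U₀ : Site d → Fin d → 𝔸ˣ) (η : ℝ) (m : ℕ) (a : ℕ → ℝ) (Λs : ℕ → Set (Site d)) (P : ℕ)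

/-- **THE REGIME «`Δ′_a(U₀)` IS INVERTIBLE ON `L²(T_P, ·)`»** — Thm 3.11's first clause on the torus as a `Prop` (proved at `U₀ = 1` in §3 and wherever the form
is positive). [cite: Balaban1985BackgroundPropagators, Thm 3.11 p.416, (3.24) p.394] -/
def RegularPrimePer : Prop := Function.Bijective (deltaPrimeAPer (𝔸 := 𝔸) (d := d) L U₀ η m a Λs P)

open Classical in
/-- ★ **`G′(U₀) := (Δ′_a(U₀))⁻¹` ON `L²(T_P, ·)` AS A TOTAL OBJECT** («Its inverse is denoted by G′, or G′(U)»): the inverse linear map in the regime, `0` off it.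
[cite: Balaban1985BackgroundPropagators, (3.24) p.394, Thm 3.11 p.416] -/
def GpPer : perSub (𝔸 := 𝔸) (d := d) P →ₗ[ℝ] perSub (𝔸 := 𝔸) (d := d) P :=
  if h : RegularPrimePer L U₀ η m a Λs P then
    ((LinearEquiv.ofBijective (deltaPrimeAPer L U₀ η m a Λs P) h).symm : perSub (𝔸 := 𝔸) (d := d) P →ₗ[ℝ] perSub (𝔸 := 𝔸) (d := d) P)
  else 0

variable {L U₀ η m a Λs P}

/-- **`G′(U₀)(Δ′_a(U₀)f) = f`** in the regime. [cite: Balaban1985BackgroundPropagators, (3.24) p.394] -/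
theorem GpPer_deltaPrimeAPer (h : RegularPrimePer L U₀ η m a Λs P) (f : perSub (𝔸 := 𝔸) (d := d) P) :
    GpPer L U₀ η m a Λs P (deltaPrimeAPer L U₀ η m a Λs P f) = f := by
  rw [GpPer, dif_pos h, LinearEquiv.coe_coe, ← LinearEquiv.ofBijective_apply (hf := h), LinearEquiv.symm_apply_apply]

/-- **`Δ′_a(U₀)(G′(U₀)f) = f`** in the regime. [cite: Balaban1985BackgroundPropagators, (3.24) p.394] -/
theorem deltaPrimeAPer_GpPer (h : RegularPrimePer L U₀ η m a Λs P) (f : perSub (𝔸 := 𝔸) (d := d) P) :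
    deltaPrimeAPer L U₀ η m a Λs P (GpPer L U₀ η m a Λs P f) = f := by
  rw [GpPer, dif_pos h, LinearEquiv.coe_coe, ← LinearEquiv.ofBijective_apply (hf := h), LinearEquiv.apply_symm_apply]

/-- `G′(U₀) = 0` off the regime (total-object convention). [cite: Balaban1985BackgroundPropagators, (3.24) p.394 (bookkeeping)] -/
theorem GpPer_of_not (h : ¬ RegularPrimePer L U₀ η m a Λs P) : GpPer (𝔸 := 𝔸) (d := d) L U₀ η m a Λs P = 0 := by
  rw [GpPer, dif_neg h]

/-- `G′(U₀)` is injective in the regime. [cite: Balaban1985BackgroundPropagators, (3.24) p.394] -/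
theorem GpPer_injective (h : RegularPrimePer L U₀ η m a Λs P) : Function.Injective (GpPer (𝔸 := 𝔸) (d := d) L U₀ η m a Λs P) := by
  intro f g hfg
  have := congrArg (deltaPrimeAPer L U₀ η m a Λs P) hfg
  rwa [deltaPrimeAPer_GpPer h, deltaPrimeAPer_GpPer h] at this

variable [NeZero P]

/-- ★ **`G′(U₀)` IS POSITIVE DEFINITE WHERE `Δ′_a(U₀)` IS POSITIVE**: `⟨G′f, f⟩ = ⟨G′f, Δ′_a(G′f)⟩ > 0` for `f ≠ 0` («the operators Δ′_a, G′ … are positive definite»).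
[cite: Balaban1985BackgroundPropagators, Thm 3.11 p.416] -/
theorem formPer_GpPer_self_pos [FiniteDimensional ℝ 𝔸]
    (hpos : ∀ f : perSub (𝔸 := 𝔸) (d := d) P, f ≠ 0 → 0 < formPer τ P f (deltaPrimeAPer L U₀ η m a Λs P f))
    {f : perSub (𝔸 := 𝔸) (d := d) P} (hf : f ≠ 0) :
    0 < formPer τ P (GpPer L U₀ η m a Λs P f) f := by
  have hreg : RegularPrimePer L U₀ η m a Λs P := bijective_of_form_pos τ hpos
  have hne : GpPer L U₀ η m a Λs P f ≠ 0 := by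
    intro h0
    apply hf
    have := congrArg (deltaPrimeAPer L U₀ η m a Λs P) h0
    rwa [deltaPrimeAPer_GpPer hreg, map_zero] at this
  have h := hpos _ hne
  rwa [deltaPrimeAPer_GpPer hreg] at h

omit [NeZero P] in
/-- `G′(U₀)` IS SYMMETRIC for the torus pairing whenever `Δ′_a(U₀)` is (in the regime; Hermitian `τ`). [cite: Balaban1985BackgroundPropagators, (3.24) p.394, Thm 3.11 p.416] -/
theorem formPer_GpPer_symm (hτs : ∀ a : 𝔸, τ (star a) = starRingEnd ℂ (τ a)) (hreg : RegularPrimePer L U₀ η m a Λs P)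
    (hsymm : ∀ f g : perSub (𝔸 := 𝔸) (d := d) P,
      formPer τ P g (deltaPrimeAPer L U₀ η m a Λs P f) = formPer τ P f (deltaPrimeAPer L U₀ η m a Λs P g))
    (f g : perSub (𝔸 := 𝔸) (d := d) P) :
    formPer τ P (GpPer L U₀ η m a Λs P f) g = formPer τ P f (GpPer L U₀ η m a Λs P g) := by
  have hf : deltaPrimeAPer L U₀ η m a Λs P (GpPer L U₀ η m a Λs P f) = f := deltaPrimeAPer_GpPer hreg f
  have hg : deltaPrimeAPer L U₀ η m a Λs P (GpPer L U₀ η m a Λs P g) = g := deltaPrimeAPer_GpPer hreg g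
  calc formPer τ P (GpPer L U₀ η m a Λs P f) g
      = formPer τ P (GpPer L U₀ η m a Λs P f) (deltaPrimeAPer L U₀ η m a Λs P (GpPer L U₀ η m a Λs P g)) := by rw [hg]
    _ = formPer τ P (GpPer L U₀ η m a Λs P g) (deltaPrimeAPer L U₀ η m a Λs P (GpPer L U₀ η m a Λs P f)) := hsymm _ _
    _ = formPer τ P (GpPer L U₀ η m a Λs P g) f := by rw [hf]
    _ = formPer τ P f (GpPer L U₀ η m a Λs P g) := (B9Eq321LandauProjectionZdPer.formPer_isSymm τ P hτs).eq _ _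

/-- ★ **THE FLAT BACKGROUND IS IN THE REGIME**: `RegularPrimePer L 1 η m a Λs P` under the hypotheses of `deltaPrimeAPer_one_bijective`.
[cite: Balaban1985BackgroundPropagators, Thm 3.11 p.416] -/
theorem regularPrimePer_one [NeZero L] [FiniteDimensional ℝ 𝔸] (hη : η ≠ 0) (hL : 1 ≤ L) (hτt : ∀ a b : 𝔸, τ (a * b) = τ (b * a))
    (hτp : ∀ a : 𝔸, a ≠ 0 → 0 < (τ (star a * a)).re)
    (hP : L ^ m ∣ P) (ha : ∀ j, 0 ≤ a j) {j₀ : ℕ} (hj₀ : j₀ ≤ m) (haj₀ : 0 < a j₀)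
    (hΛ₀ : IsPeriodic (P / L ^ j₀) fun y => y ∈ Λs j₀) (hne : (Λs j₀).Nonempty) :
    RegularPrimePer L (1 : Site d → Fin d → 𝔸ˣ) η m a Λs P :=
  deltaPrimeAPer_one_bijective τ hη hL hτt hτp hP ha hj₀ haj₀ hΛ₀ hne

end GreenPrime

/-! ## §5  A6 ∕ non-vacuity: the abelian fibre on the torus at the flat background, torus constraint sets -/

section Witness

variable {L : ℕ} [NeZero L] {η : ℝ} {m : ℕ} {a : ℕ → ℝ} {P : ℕ} [NeZero P]

/-- **A6 ∕ NON-VACUITY — THE ABELIAN FIBRE, THE TORUS CONSTRAINT SETS**: for `𝔸 = ℂ` (the `U(1)` case) with `τ = id` the three trace properties hold; with the torus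
members' constraint sets (`Λ_j = ∅` for `j ≠ m`, `Λ_m = ℤᵈ` — the shape of `B8Thm4TorusAt.torusLam`), `Lᵐ ∣ P`, `η ≠ 0`, `a ≥ 0` with `a_m > 0`, every hypothesis of
`deltaPrimeAPer_one_bijective` is discharged: `Δ′_a(1)` IS invertible on `L²(T_P)` with NO hypothesis left. [cite: Balaban1985BackgroundPropagators, Thm 3.11 p.416, (3.24) p.394; Balaban1985RegularSpaces, (1.28) p.81, p.77 («Ω_j = T_η»)] -/
theorem deltaPrimeAPer_one_bijective_complex (hη : η ≠ 0) (hL : 1 ≤ L) (hP : L ^ m ∣ P) (ha : ∀ j, 0 ≤ a j) (ham : 0 < a m) :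
    Function.Bijective (deltaPrimeAPer (𝔸 := ℂ) (d := d) L (1 : Site d → Fin d → ℂˣ) η m a
      (fun j => if j = m then (Set.univ : Set (Site d)) else ∅) P) := by
  refine deltaPrimeAPer_one_bijective (𝔸 := ℂ) (LinearMap.id : ℂ →ₗ[ℂ] ℂ) hη hL (fun a b => by rw [mul_comm])
    (fun a ha' => ?_) hP ha le_rfl ham ?_ ?_
  · rw [LinearMap.id_apply, Complex.star_def, ← Complex.normSq_eq_conj_mul_self, Complex.ofReal_re]
    exact Complex.normSq_pos.2 ha'
  · intro y n
    simp
  · simp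

end Witness


end Literature.MathematicalPhysics.QuantumFieldTheory.Balaban1983to89.B9Eq324DeltaPrimeAZdPer

end
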